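import Summits.BirchSwinnertonDyer.BirchSwinnertonDyer.Theorems.CyclotomicUntwistWildThreeDicyclicRootUnique
import Summits.BirchSwinnertonDyer.Rank1Residual.Additive.WildThreeResidualShapeLocIrr
import Summits.BirchSwinnertonDyer.Rank1Residual.Additive.LocIrrValuationCriterionThreeProofs
import HarnessLib

/-!
# The O6 tame-torsion cell law `WildThreeTameTorsionCellLaw` IS A THEOREM: off the two cells
# `(v₃N, Kod₃) ∈ {(3, II), (3, IV*)}` every wild `W` at `3` has EXACTLY ONE `G_{ℚ₃}`-stable line in `W[3]`

Cell `pub/bsd-wall` (D-0145 line `route-BirchSwinnertonDyer-CyclotomicUntwist`), seat `bsd-line-cycu-p2`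
(prover seat 2/3, gen 4), helper toward K1 `PSRankOneLowerHalfAtThree` (stmt-BirchSwinnertonDyer-21580) and
K2 `PSRankOneUpperHalfAtThree` (stmt-21581); serves the O6 lane (o6-r1 V10, cell `b2b-bsdres`). THEOREMS
ONLY (no definition, no named fact, no `sorry`); BSD is not proved by this file and no crux is. What IS
proved: the conjecture-tagged node `Summit.BirchSwinnertonDyer.Rank1Residual.Additive.WildThreeTameTorsionCellLaw`
(`Additive/WildThreeResidualShapeLaws.lean` §2; census EVIDENCE: IRR 23 919 + SPLIT 14 938 classes, all in the
two cells) holds — `wildThreeTameTorsionCellLaw_holds` — so consumers may instantiate their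
`(h : WildThreeTameTorsionCellLaw)` binders by name. The node itself is not edited here (attribute removal
is the O6 typer's call).

## Statement and proof
For `W/ℚ` elliptic, globally minimal, on the wild cell at `3` (`ClassO6 W 3`: additive, potentially good,
`v₃N ∈ {3,4,5}`), with `v = v₃Δ_min`, `K₃` the Kodaira symbol: EITHER `(K₃, v) ∈ {(II, 3), (IV*, 9)}` (then
`v₃N = 3`: the two tame-torsion cells, where IRR / SPLIT / one-line shapes all occur) OR `Ψ₃` has exactly one
root in `ℚ₃` (`tameCell_or_existsUnique`). Cases:
* `v` even (`v₃N = 4`, rows II 4 / IV 6 / IV* 10 / II* 12): gen 3's capstone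
  `exists_isUniqueStableLineThree_of_psRow`;
* `v` odd, `v ∉ {3, 9}` — the six dicyclic cells `(II,5) (IV,5) (IV,7) (IV*,11) (II*,11) (II*,13)`
  (`kodairaSymbolAt_of_odd`, from the Papadopoulos windows `PSKodairaDictionary.kodairaSymbolAt_windows`):
  EXISTENCE of a root — `3 ∤ v`, so `W[3]|G_{ℚ₃}` is reducible (harvest-2 E89
  `three_dvd_padicValInt_minimalDiscriminantInt_of_locIrr'` + the dictionary `locIrr_three_iff_shapeIrrThree`);
  UNIQUENESS — Tate's normal form over `K_v` (`exists_variableChange_b_of_kodairaSymbolAt_wild`) feeds the six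
  `K_v` lemmas of `…WildThreeDicyclicRootUnique.lean`, transported to `ℚ₃` along `Padic.adicCompletionEquiv`.
Consequences: `exists_isUniqueStableLineThree_of_not_tameTorsionCell`, `numStableLinesAtThree_eq_one_of_not_tameTorsionCell`
(census column `nroots = 1` off the two cells), `kodaira_of_shapeIrr_or_split` (IRR ∨ SPLIT ⟹ `(K₃, v) ∈
{(II,3), (IV*,9)}` and `v₃N = 3`), and the node `wildThreeTameTorsionCellLaw_holds`.
References: J. H. Silverman, *Advanced Topics* (1994), IV.9.4 [SilvermanATAEC1994]; I. Papadopoulos, J. Number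
Theory 44 (1993), Table (p = 3) [Papadopoulos1993]; A. Kraus, Manuscripta Math. 69 (1990), Théorème (p = 3)
[Kraus1990]; J.-P. Serre, Invent. Math. 15 (1972), §1.11 [Serre1972]; J. E. Cremona, *Algorithms* (1997) §3.8
[Cremona1997].
-/

set_option autoImplicit false
-- single-conjunct summit: `Summit.BirchSwinnertonDyer.BirchSwinnertonDyer.…` repeats the name by design
set_option linter.dupNamespace false

noncomputable section

open scoped Classical

open Polynomial WeierstrassCurve IsDedekindDomain IsDedekindDomain.HeightOneSpectrum WithZero
  Rat.HeightOneSpectrum Literature.NumberTheory.EllipticCurves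
  Literature.NumberTheory.EllipticCurves.Rank1Residual Literature.NumberTheory.DiophantineGeometry
  Summit.BirchSwinnertonDyer.Rank1Residual.Additive Summit.BirchSwinnertonDyer.Rank1Residual.O5
  Summit.BirchSwinnertonDyer.Rank1Residual.O5.NonSplitAtThree

namespace Summit.BirchSwinnertonDyer.BirchSwinnertonDyer.Theorems.PSLocalThreeTorsion

/-! ## §1 Curves over `ℚ`: `Ψ₃` has at most one `ℚ₃`-root on the six dicyclic cells -/

section Curves

variable (W : WeierstrassCurve ℚ) [W.IsElliptic]

/-- **The six dicyclic cells off the tame pair: `Ψ₃` has at most one root in `ℚ_{(3)}`** —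
`(K₃, ord₃Δ_min) ∈ {(II,5), (IV,5), (IV,7), (IV*,11), (II*,11), (II*,13)}`; Tate's normal form over `K_v`
feeds the `K_v` lemma of the cell. [cite: SilvermanATAEC1994, IV.9.4 Steps 3, 5, 8, 10 and Table 4.1] -/
theorem Ψ₃_root_unique_adicCompletion_of_dicyclicCell
    (hcell : (W.kodairaSymbolAt (placeOf 3) = .II ∧ W.ordMinimalDiscriminant (placeOf 3) = 5) ∨
      (W.kodairaSymbolAt (placeOf 3) = .IV ∧ W.ordMinimalDiscriminant (placeOf 3) = 5) ∨
      (W.kodairaSymbolAt (placeOf 3) = .IV ∧ W.ordMinimalDiscriminant (placeOf 3) = 7) ∨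
      (W.kodairaSymbolAt (placeOf 3) = .IVstar ∧ W.ordMinimalDiscriminant (placeOf 3) = 11) ∨
      (W.kodairaSymbolAt (placeOf 3) = .IIstar ∧ W.ordMinimalDiscriminant (placeOf 3) = 11) ∨
      (W.kodairaSymbolAt (placeOf 3) = .IIstar ∧ W.ordMinimalDiscriminant (placeOf 3) = 13))
    (x y : (placeOf 3).adicCompletion ℚ)
    (hx : (W.baseChange ((placeOf 3).adicCompletion ℚ)).Ψ₃.eval x = 0)
    (hy : (W.baseChange ((placeOf 3).adicCompletion ℚ)).Ψ₃.eval y = 0) : x = y := by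
  haveI : PerfectField (IsLocalRing.ResidueField ((placeOf 3).adicCompletionIntegers ℚ)) :=
    PerfectField.ofFinite
  have h2 : ringChar (ℤ ⧸ (placeOf 3).asIdeal) ≠ 2 := by rw [ringChar_int_quot_placeOf 3]; decide
  have hgen : natGenerator (placeOf 3) = 3 :=
    Literature.NumberTheory.EllipticCurves.Rat.natGenerator_primesEquiv_symm ⟨3, Nat.prime_three⟩
  have hπ : (placeOf 3).valuation ℚ (3 : ℚ) = exp (-1 : ℤ) := by
    have h := valuation_natGenerator_int (placeOf 3)
    rwa [hgen, Nat.cast_ofNat] at h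
  have h3 : algebraMap ℚ ((placeOf 3).adicCompletion ℚ) 3 = 3 := map_ofNat _ 3
  rcases hcell with ⟨hT, hord⟩ | ⟨hT, hord⟩ | ⟨hT, hord⟩ | ⟨hT, hord⟩ | ⟨hT, hord⟩ | ⟨hT, hord⟩
  · obtain ⟨C, β₂, β₄, β₆, δ, hβ₆, hδ, hb₂, hb₄, hb₆, hΔ⟩ :=
      W.exists_variableChange_b_of_kodairaSymbolAt_wild (placeOf 3) h2 (Or.inl ⟨hT, rfl, rfl, rfl⟩) hπ
    rw [hord] at hΔ
    exact Ψ₃_root_unique_of_variableChange _ C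
      (Ψ₃_root_unique_of_shapeII_five (placeOf 3) hπ h3 _ β₂ β₄ β₆ δ hβ₆ hδ hb₂ hb₄ hb₆ hΔ) x y hx hy
  · obtain ⟨C, β₂, β₄, β₆, δ, hβ₆, hδ, hb₂, hb₄, hb₆, hΔ⟩ :=
      W.exists_variableChange_b_of_kodairaSymbolAt_wild (placeOf 3) h2
        (Or.inr (Or.inl ⟨hT, rfl, rfl, rfl⟩)) hπ
    rw [hord] at hΔ
    exact Ψ₃_root_unique_of_variableChange _ C
      (Ψ₃_root_unique_of_shapeIV_five (placeOf 3) hπ h3 _ β₂ β₄ β₆ δ hβ₆ hδ hb₂ hb₄ hb₆ hΔ) x y hx hy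
  · obtain ⟨C, β₂, β₄, β₆, δ, hβ₆, hδ, hb₂, hb₄, hb₆, hΔ⟩ :=
      W.exists_variableChange_b_of_kodairaSymbolAt_wild (placeOf 3) h2
        (Or.inr (Or.inl ⟨hT, rfl, rfl, rfl⟩)) hπ
    rw [hord] at hΔ
    exact Ψ₃_root_unique_of_variableChange _ C
      (Ψ₃_root_unique_of_shapeIV_seven (placeOf 3) hπ h3 _ β₂ β₄ β₆ δ hβ₆ hδ hb₂ hb₄ hb₆ hΔ) x y hx hy
  · obtain ⟨C, β₂, β₄, β₆, δ, hβ₆, hδ, hb₂, hb₄, hb₆, hΔ⟩ :=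
      W.exists_variableChange_b_of_kodairaSymbolAt_wild (placeOf 3) h2
        (Or.inr (Or.inr (Or.inl ⟨hT, rfl, rfl, rfl⟩))) hπ
    rw [hord] at hΔ
    exact Ψ₃_root_unique_of_variableChange _ C
      (Ψ₃_root_unique_of_shapeIVstar_eleven (placeOf 3) hπ h3 _ β₂ β₄ β₆ δ hβ₆ hδ hb₂ hb₄ hb₆ hΔ)
      x y hx hy
  · obtain ⟨C, β₂, β₄, β₆, δ, hβ₆, hδ, hb₂, hb₄, hb₆, hΔ⟩ :=
      W.exists_variableChange_b_of_kodairaSymbolAt_wild (placeOf 3) h2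
        (Or.inr (Or.inr (Or.inr ⟨hT, rfl, rfl, rfl⟩))) hπ
    rw [hord] at hΔ
    exact Ψ₃_root_unique_of_variableChange _ C
      (Ψ₃_root_unique_of_shapeIIstar_eleven (placeOf 3) hπ h3 _ β₂ β₄ β₆ δ hβ₆ hδ hb₂ hb₄ hb₆ hΔ)
      x y hx hy
  · obtain ⟨C, β₂, β₄, β₆, δ, hβ₆, hδ, hb₂, hb₄, hb₆, hΔ⟩ :=
      W.exists_variableChange_b_of_kodairaSymbolAt_wild (placeOf 3) h2
        (Or.inr (Or.inr (Or.inr ⟨hT, rfl, rfl, rfl⟩))) hπ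
    rw [hord] at hΔ
    exact Ψ₃_root_unique_of_variableChange _ C
      (Ψ₃_root_unique_of_shapeIIstar_thirteen (placeOf 3) hπ h3 _ β₂ β₄ β₆ δ hβ₆ hδ hb₂ hb₄ hb₆ hΔ)
      x y hx hy

/-- **… and hence at most one root in `ℚ₃`** (transport along `Padic.adicCompletionEquiv`).
[cite: SilvermanATAEC1994, IV.9.4 and Table 4.1] -/
theorem Ψ₃_root_unique_padic_of_dicyclicCell
    (hcell : (W.kodairaSymbolAt (placeOf 3) = .II ∧ W.ordMinimalDiscriminant (placeOf 3) = 5) ∨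
      (W.kodairaSymbolAt (placeOf 3) = .IV ∧ W.ordMinimalDiscriminant (placeOf 3) = 5) ∨
      (W.kodairaSymbolAt (placeOf 3) = .IV ∧ W.ordMinimalDiscriminant (placeOf 3) = 7) ∨
      (W.kodairaSymbolAt (placeOf 3) = .IVstar ∧ W.ordMinimalDiscriminant (placeOf 3) = 11) ∨
      (W.kodairaSymbolAt (placeOf 3) = .IIstar ∧ W.ordMinimalDiscriminant (placeOf 3) = 11) ∨
      (W.kodairaSymbolAt (placeOf 3) = .IIstar ∧ W.ordMinimalDiscriminant (placeOf 3) = 13))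
    (r s : ℚ_[3]) (hr : ((W.baseChange ℚ_[3]).Ψ₃).IsRoot r) (hs : ((W.baseChange ℚ_[3]).Ψ₃).IsRoot s) :
    r = s := by
  set Kv := (placeOf 3).adicCompletion ℚ
  let e : ℚ_[3] ≃ₐ[ℚ] Kv := (Padic.adicCompletionEquiv ℤ ⟨3, Nat.prime_three⟩).toAlgEquiv
  have he : ∀ c : ℚ_[3], ((W.baseChange ℚ_[3]).Ψ₃).IsRoot c → (W.baseChange Kv).Ψ₃.eval (e c) = 0 := by
    intro c hc
    rw [IsRoot.def, WeierstrassCurve.baseChange, map_Ψ₃, eval_map, ← aeval_def] at hc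
    rw [WeierstrassCurve.baseChange, map_Ψ₃, eval_map, ← aeval_def, aeval_algHom_apply, hc, map_zero]
  exact e.injective
    (Ψ₃_root_unique_adicCompletion_of_dicyclicCell W hcell (e r) (e s) (he r hr) (he s hs))

variable [W.IsGloballyMinimal]

/-- **On the wild cell with `v₃Δ_min` odd, `(K₃, v, v₃N)` is one of the eight dicyclic rows**
`(II,3,3) (II,5,5) (IV,5,3) (IV,7,5) (IV*,9,3) (IV*,11,5) (II*,11,3) (II*,13,5)` (odd entries of the
Papadopoulos windows; Ogg's formula for `v₃N`). [cite: Papadopoulos1993, Table (p = 3)] [cite: SilvermanATAEC1994, IV.9.4 and Table 4.1] -/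
theorem kodairaSymbolAt_of_odd (hadd : Addv W 3) (hW : SubW W 3)
    (hodd : Odd (padicValInt 3 W.minimalDiscriminantInt)) :
    (W.kodairaSymbolAt (placeOf 3) = .II ∧ padicValInt 3 W.minimalDiscriminantInt = 3 ∧ condExp W 3 = 3) ∨
    (W.kodairaSymbolAt (placeOf 3) = .II ∧ padicValInt 3 W.minimalDiscriminantInt = 5 ∧ condExp W 3 = 5) ∨
    (W.kodairaSymbolAt (placeOf 3) = .IV ∧ padicValInt 3 W.minimalDiscriminantInt = 5 ∧ condExp W 3 = 3) ∨
    (W.kodairaSymbolAt (placeOf 3) = .IV ∧ padicValInt 3 W.minimalDiscriminantInt = 7 ∧ condExp W 3 = 5) ∨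
    (W.kodairaSymbolAt (placeOf 3) = .IVstar ∧ padicValInt 3 W.minimalDiscriminantInt = 9 ∧
      condExp W 3 = 3) ∨
    (W.kodairaSymbolAt (placeOf 3) = .IVstar ∧ padicValInt 3 W.minimalDiscriminantInt = 11 ∧
      condExp W 3 = 5) ∨
    (W.kodairaSymbolAt (placeOf 3) = .IIstar ∧ padicValInt 3 W.minimalDiscriminantInt = 11 ∧
      condExp W 3 = 3) ∨
    (W.kodairaSymbolAt (placeOf 3) = .IIstar ∧ padicValInt 3 W.minimalDiscriminantInt = 13 ∧
      condExp W 3 = 5) := by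
  rw [Nat.odd_iff] at hodd
  rcases PSKodairaDictionary.kodairaSymbolAt_windows W hadd hW with
    ⟨hK, h1, h2, h3⟩ | ⟨hK, h1, h2, h3⟩ | ⟨hK, h1, h2, h3⟩ | ⟨hK, h1, h2, h3⟩
  · rcases (show padicValInt 3 W.minimalDiscriminantInt = 3 ∨
        padicValInt 3 W.minimalDiscriminantInt = 5 by omega) with h | h
    · exact Or.inl ⟨hK, h, by omega⟩
    · exact Or.inr (Or.inl ⟨hK, h, by omega⟩)
  · rcases (show padicValInt 3 W.minimalDiscriminantInt = 5 ∨
        padicValInt 3 W.minimalDiscriminantInt = 7 by omega) with h | h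
    · exact Or.inr (Or.inr (Or.inl ⟨hK, h, by omega⟩))
    · exact Or.inr (Or.inr (Or.inr (Or.inl ⟨hK, h, by omega⟩)))
  · rcases (show padicValInt 3 W.minimalDiscriminantInt = 9 ∨
        padicValInt 3 W.minimalDiscriminantInt = 11 by omega) with h | h
    · exact Or.inr (Or.inr (Or.inr (Or.inr (Or.inl ⟨hK, h, by omega⟩))))
    · exact Or.inr (Or.inr (Or.inr (Or.inr (Or.inr (Or.inl ⟨hK, h, by omega⟩)))))
  · rcases (show padicValInt 3 W.minimalDiscriminantInt = 11 ∨
        padicValInt 3 W.minimalDiscriminantInt = 13 by omega) with h | h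
    · exact Or.inr (Or.inr (Or.inr (Or.inr (Or.inr (Or.inr (Or.inl ⟨hK, h, by omega⟩))))))
    · exact Or.inr (Or.inr (Or.inr (Or.inr (Or.inr (Or.inr (Or.inr ⟨hK, h, by omega⟩))))))

/-- **`3 ∤ v₃Δ_min ⟹ Ψ₃` has a root in `ℚ₃`** (an irreducible `W[3]|G_{ℚ₃}` has `3 ∣ v₃Δ_min` — harvest-2
E89 — and "no `ℚ₃`-root" IS local irreducibility). [cite: Cremona1997, §3.8 (l = 3)] [cite: Serre1972, §1.11 Prop. 10] -/
theorem exists_isRoot_Ψ₃_padic_of_not_three_dvd (hnd : ¬ 3 ∣ padicValInt 3 W.minimalDiscriminantInt) :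
    ∃ r : ℚ_[3], ((W.baseChange ℚ_[3]).Ψ₃).IsRoot r := by
  by_contra h
  push Not at h
  have hL : LocIrr W 3 := (locIrr_three_iff_shapeIrrThree W).mpr h
  have h3 := three_dvd_padicValInt_minimalDiscriminantInt_of_locIrr' W hL
  exact hnd (by exact_mod_cast h3)

/-- **The six dicyclic cells off the tame pair carry EXACTLY ONE stable line**
(`(K₃, v₃Δ_min) ∈ {(II,5), (IV,5), (IV,7), (IV*,11), (II*,11), (II*,13)}`: existence since `3 ∤ v`, uniqueness by
Tate's normal forms). [cite: SilvermanATAEC1994, IV.9.4] [cite: Serre1972, §1.11] -/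
theorem exists_isUniqueStableLineThree_of_dicyclicCell
    (hcell : (W.kodairaSymbolAt (placeOf 3) = .II ∧ W.ordMinimalDiscriminant (placeOf 3) = 5) ∨
      (W.kodairaSymbolAt (placeOf 3) = .IV ∧ W.ordMinimalDiscriminant (placeOf 3) = 5) ∨
      (W.kodairaSymbolAt (placeOf 3) = .IV ∧ W.ordMinimalDiscriminant (placeOf 3) = 7) ∨
      (W.kodairaSymbolAt (placeOf 3) = .IVstar ∧ W.ordMinimalDiscriminant (placeOf 3) = 11) ∨
      (W.kodairaSymbolAt (placeOf 3) = .IIstar ∧ W.ordMinimalDiscriminant (placeOf 3) = 11) ∨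
      (W.kodairaSymbolAt (placeOf 3) = .IIstar ∧ W.ordMinimalDiscriminant (placeOf 3) = 13)) :
    ∃ x₀, IsUniqueStableLineThree W x₀ := by
  have hnd : ¬ 3 ∣ padicValInt 3 W.minimalDiscriminantInt := by
    rw [← ordMinimalDiscriminant_placeOf_eq W 3]
    rcases hcell with ⟨-, h⟩ | ⟨-, h⟩ | ⟨-, h⟩ | ⟨-, h⟩ | ⟨-, h⟩ | ⟨-, h⟩ <;> rw [h] <;> decide
  obtain ⟨r, hr⟩ := exists_isRoot_Ψ₃_padic_of_not_three_dvd W hnd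
  exact ⟨r, hr, fun s hs ↦ Ψ₃_root_unique_padic_of_dicyclicCell W hcell s r hs hr⟩

/-- **DICHOTOMY on the wild cell at `3`**: either `W` sits in one of the two tame-torsion cells
(`(K₃, v₃Δ_min) ∈ {(II, 3), (IV*, 9)}`, both with `v₃N = 3`), or `Ψ₃` has exactly one root in `ℚ₃`
(`v` even: gen 3's `exists_isUniqueStableLineThree_of_psRow`; `v` odd off the pair: the dicyclic cells).
[cite: Kraus1990, Théorème (p = 3)] [cite: SilvermanATAEC1994, IV.9.4] [cite: Serre1972, §1.11] -/
theorem tameCell_or_existsUnique (hO6 : ClassO6 W 3) :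
    (condExp W 3 = 3 ∧
      ((W.kodairaSymbolAt (placeOf 3) = .II ∧ padicValInt 3 W.minimalDiscriminantInt = 3) ∨
        (W.kodairaSymbolAt (placeOf 3) = .IVstar ∧ padicValInt 3 W.minimalDiscriminantInt = 9))) ∨
    ∃ x₀, IsUniqueStableLineThree W x₀ := by
  rcases Nat.even_or_odd (padicValInt 3 W.minimalDiscriminantInt) with hev | hodd
  · exact Or.inr (exists_isUniqueStableLineThree_of_psRow W hO6 hev)
  have hord := ordMinimalDiscriminant_placeOf_eq W 3
  rcases kodairaSymbolAt_of_odd W hO6.2.1 hO6.2.2 hodd with ⟨hK, hv, hf⟩ | ⟨hK, hv, -⟩ | ⟨hK, hv, -⟩ |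
    ⟨hK, hv, -⟩ | ⟨hK, hv, hf⟩ | ⟨hK, hv, -⟩ | ⟨hK, hv, -⟩ | ⟨hK, hv, -⟩
  · exact Or.inl ⟨hf, Or.inl ⟨hK, hv⟩⟩
  · exact Or.inr (exists_isUniqueStableLineThree_of_dicyclicCell W (Or.inl ⟨hK, by rw [hord, hv]⟩))
  · exact Or.inr (exists_isUniqueStableLineThree_of_dicyclicCell W (Or.inr (Or.inl ⟨hK, by rw [hord, hv]⟩)))
  · exact Or.inr (exists_isUniqueStableLineThree_of_dicyclicCell W
      (Or.inr (Or.inr (Or.inl ⟨hK, by rw [hord, hv]⟩))))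
  · exact Or.inl ⟨hf, Or.inr ⟨hK, hv⟩⟩
  · exact Or.inr (exists_isUniqueStableLineThree_of_dicyclicCell W
      (Or.inr (Or.inr (Or.inr (Or.inl ⟨hK, by rw [hord, hv]⟩)))))
  · exact Or.inr (exists_isUniqueStableLineThree_of_dicyclicCell W
      (Or.inr (Or.inr (Or.inr (Or.inr (Or.inl ⟨hK, by rw [hord, hv]⟩))))))
  · exact Or.inr (exists_isUniqueStableLineThree_of_dicyclicCell W
      (Or.inr (Or.inr (Or.inr (Or.inr (Or.inr ⟨hK, by rw [hord, hv]⟩))))))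

/-- **Off the two tame-torsion cells there is exactly one stable line.**
[cite: Kraus1990, Théorème (p = 3)] [cite: Serre1972, §1.11] -/
theorem exists_isUniqueStableLineThree_of_not_tameTorsionCell (hO6 : ClassO6 W 3)
    (hcell : tameTorsionCellThree (condExp W 3) (W.kodairaSymbolAt (placeOf 3)) = false) :
    ∃ x₀, IsUniqueStableLineThree W x₀ := by
  rcases tameCell_or_existsUnique W hO6 with ⟨hf, ⟨hK, -⟩ | ⟨hK, -⟩⟩ | h
  · rw [hf, hK] at hcell; exact absurd hcell (by decide)
  · rw [hf, hK] at hcell; exact absurd hcell (by decide)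
  · exact h

/-- The census column off the two cells: `numStableLinesAtThree W = 1`. [folklore] -/
theorem numStableLinesAtThree_eq_one_of_not_tameTorsionCell (hO6 : ClassO6 W 3)
    (hcell : tameTorsionCellThree (condExp W 3) (W.kodairaSymbolAt (placeOf 3)) = false) :
    numStableLinesAtThree W = 1 :=
  (numStableLinesAtThree_eq_one_iff W).mpr (exists_isUniqueStableLineThree_of_not_tameTorsionCell W hO6 hcell)

/-- **IRR or SPLIT ⟹ `(K₃, v₃Δ_min) ∈ {(II, 3), (IV*, 9)}` and `v₃N = 3`** (no stable line, or two, is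
incompatible with exactly one). [cite: Kraus1990, Théorème (p = 3)] [cite: Serre1972, §1.11] -/
theorem kodaira_of_shapeIrr_or_split (hO6 : ClassO6 W 3) (h : ShapeIrrThree W ∨ ShapeSplitThree W) :
    condExp W 3 = 3 ∧
      ((W.kodairaSymbolAt (placeOf 3) = .II ∧ padicValInt 3 W.minimalDiscriminantInt = 3) ∨
        (W.kodairaSymbolAt (placeOf 3) = .IVstar ∧ padicValInt 3 W.minimalDiscriminantInt = 9)) := by
  rcases tameCell_or_existsUnique W hO6 with hc | ⟨x₀, hx⟩
  · exact hc
  · exfalso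
    rcases h with hirr | ⟨r, r', hne, hr, hr'⟩
    · exact hirr x₀ hx.1
    · exact hne ((hx.2 r hr).trans (hx.2 r' hr').symm)

end Curves

/-! ## §2 The node -/

/-- **THE O6 TAME-TORSION CELL LAW HOLDS** (o6-r1 GEN 10 V10; was conjecture-tagged, census IRR 23 919 +
SPLIT 14 938 classes in the two cells, 0 elsewhere): for every elliptic, globally minimal `W/ℚ` on the wild
cell at `3` (`ClassO6 W 3`), if `W[3]|G_{ℚ₃}` is irreducible (no `ℚ₃`-root of `Ψ₃`) or split (two roots)
then `(v₃N, K₃) ∈ {(3, II), (3, IV*)}`. [cite: Kraus1990, Théorème (p = 3)] [cite: SilvermanATAEC1994, IV.9.4]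
[cite: Serre1972, §1.11] -/
theorem wildThreeTameTorsionCellLaw_holds : WildThreeTameTorsionCellLaw := by
  intro W _ _ hO6 hshape
  obtain ⟨hf, ⟨hK, -⟩ | ⟨hK, -⟩⟩ := kodaira_of_shapeIrr_or_split W hO6 hshape
  · rw [hf, hK]; rfl
  · rw [hf, hK]; rfl

end Summit.BirchSwinnertonDyer.BirchSwinnertonDyer.Theorems.PSLocalThreeTorsion

end
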